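import Summits.BirchSwinnertonDyer.BirchSwinnertonDyer.Theorems.EisensteinDepletionAtTwoStarOptBNSFNsfDoorStevens
import HarnessLib

/-!
# Line `star` on crux E1M (stmt-BirchSwinnertonDyer-20341), squarefree residue: «Stevens at 2» for the `X₁(N)`-type curve AT EVERY LEVEL

Lead star-p1 GEN 15.  The tree's `NsfDoor.parityCoverWt` / `NsfDoor.stevensAtTwoX1Int` (line `nsf`, crux StarOptBNSF 27047) carry the
binders `¬ 2 ∣ N`, «a traceless prime `p ∣ N`» and `IsOrdinaryAt W₁ 2`, but their proof never uses them (they are introduced as `_`):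
the Kummer-form / unbounded-denominators argument is level-blind.  This file records the level-free statements, which are what the
SQUAREFREE half of `StarOptB` (registered stub `stub_starOptBSF` of line `star` v6) needs — at squarefree level there is no traceless
prime.

* `parityCoverWt_allLevels` — the weight-free parity-cover statement for a FORMAL rational 2-torsion point of a curve `W₁` whose Néron
  lattice is `c₁Λ₁(f)` with `c₁ ∈ ℤ` (any level `N`): the parity cover carries a non-zero anti-invariant cusp form with an integral
  multiple (verbatim the body of `NsfDoor.parityCoverWt`).
* `stevensAtTwoX1Int_allLevels` — «Stevens at 2», every level: such a `W₁` has NO formal rational 2-torsion point, modulo the named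
  fact `CalegariDimitrovTang2025_unboundedDenominators`.

CONDITIONAL on UBD; no `sorry`, no new definition; nothing here reads `r_an`; StarOptB / E1M / BSD are NOT proved by this file.
-/

set_option linter.dupNamespace false
set_option autoImplicit false

noncomputable section

namespace Summit.BirchSwinnertonDyer.BirchSwinnertonDyer.Theorems.DepletionAtTwo.StevensAllLevels

open scoped MatrixGroups ModularForm
open Literature.NumberTheory.EllipticCurves
open Literature.NumberTheory.EllipticCurves.Greenberg1999
open Literature.NumberTheory.EllipticCurves.ModularForms

/-- **The weight-free parity-cover statement, at every level.**  For `W₁/ℚ` globally minimal elliptic with a newform `f ∈ S₂(Γ₀(N))`,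
Néron lattice `L₁ = c₁Λ₁(f)` with `c₁ ∈ ℤ ∖ {0}`, a FORMAL rational 2-torsion abscissa `x₁` (`v₂(x₁) < 0`) with half-period `λ/2`, and the
parity group `Γ′` of `λ`: `Γ′` carries a non-zero cusp form, anti-invariant under `Γ₁(N) ∖ Γ′`, some non-zero integer multiple of which
has an integral `q`-expansion.  Verbatim the proof of `NsfDoor.parityCoverWt` (formal square root `…FormalSqrt`, Honda at every prime
`…ParamIntegral`, parameter expansion `…ParamExpansion`, bounded denominators on `Γ₁(N)` for `N ≥ 11` `…Gamma1Bounded`, monolith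
`NsfDoor.sqrtCuspForm`) with the three unused binders (`¬ 2 ∣ N`, traceless prime, ordinary at `2`) dropped.
[cite: SilvermanAEC2009, IV.1, VI.3.6] [cite: ShimuraIATAF1971, Thm. 3.52] -/
theorem parityCoverWt_allLevels :
    ∀ (W₁ : WeierstrassCurve ℚ) [W₁.IsElliptic] [W₁.IsGloballyMinimal]
      ⦃N : ℕ⦄ [NeZero N] (f : CuspForm (CongruenceSubgroup.Gamma0 N) 2), IsNewformOf W₁ f →
      ∀ (L₁ : PeriodPair), IsNeronLatticeOf (W₁.baseChange ℂ) L₁ →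
      ∀ (c₁ : ℚ), c₁ ≠ 0 → (∀ z ∈ periodLatticeGamma1 f, (c₁ : ℂ) * z ∈ L₁.lattice) →
      (∀ z ∈ L₁.lattice, ∃ w ∈ periodLatticeGamma1 f, z = (c₁ : ℂ) * w) →
      (∃ m : ℤ, (m : ℚ) = c₁) →
      ∀ (x₁ : ℚ), HasRationalTwoTorsionX W₁ x₁ → TwoTorsionRamifiedAtTwo x₁ →
      ∀ (lam : ℂ), lam ∈ L₁.lattice → lam / 2 ∉ L₁.lattice →
        L₁.weierstrassP (lam / 2) - ((W₁.b₂ : ℚ) : ℂ) / 12 = ((x₁ : ℚ) : ℂ) →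
        ∀ (Γ' : Subgroup SL(2, ℤ)),
          (∀ γ : SL(2, ℤ), γ ∈ Γ' ↔ ∃ hγ : γ ∈ CongruenceSubgroup.Gamma0 N, γ ∈ CongruenceSubgroup.Gamma1 N ∧
            ∃ k : ℤ, ∃ w ∈ L₁.lattice, (c₁ : ℂ) * cuspSymbol f ⟨γ, hγ⟩ = (k : ℂ) * lam + 2 * w) →
          ∃ (k : ℤ) (h : CuspForm Γ' k) (M : ℕ),
            (h : UpperHalfPlane → ℂ) ≠ 0 ∧
            (∀ γ ∈ CongruenceSubgroup.Gamma1 N, γ ∉ Γ' → (h : UpperHalfPlane → ℂ) ∣[k] γ = -h) ∧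
            M ≠ 0 ∧
            ∀ n : ℕ, ∃ z : ℤ,
              PowerSeries.coeff n
                (UpperHalfPlane.qExpansion (1 : ℝ) (fun τ : UpperHalfPlane ↦ (M : ℂ) * h τ)) = (z : ℂ) := by
  intro W₁ _ _ N _ f hW₁ L₁ hL₁ c₁ hc₁ hin hout hint x₁ hx₁ hram lam hlam hlam2 hwp Γ' hΓ
  have hZ := Summit.BirchSwinnertonDyer.BirchSwinnertonDyer.Theorems.DepletionAtTwo.ParamExpansion.stub_paramExpansion
  -- the level of a newform of an elliptic curve is at least `11`
  have h11 : 11 ≤ N := by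
    by_contra hlt
    have hf0 : f = 0 := cuspForm_two_gamma0_eq_zero_of_le_ten (by omega) f
    have h1 : cuspCoeff f 1 = (W₁.LFunction 1 : ℂ) := hW₁.2 1
    rw [hf0, WeierstrassCurve.LFunction_apply_one] at h1
    have h0 : cuspCoeff (0 : CuspForm (CongruenceSubgroup.Gamma0 N) 2) 1 = 0 :=
      (cuspCoeffₗ (one_mem_strictPeriods_coe_gamma0 N) 1).map_zero
    rw [h0] at h1
    norm_num at h1
  -- S1 (closed): the formal square root with coefficients in `½ℤ`
  obtain ⟨B, hB0, hBsq, hBhalf⟩ :=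
    Summit.BirchSwinnertonDyer.BirchSwinnertonDyer.Theorems.DepletionAtTwo.FormalSqrt.exists_formalSqrt_half_integral W₁ hx₁ hram
  -- the integer Manin constant
  obtain ⟨m, hm⟩ := hint
  subst hm
  -- S2a (closed): the integer series `Z = exp(m·ℓ)`; S2b: it is the expansion of `−x/y`
  choose k hk using Summit.BirchSwinnertonDyer.BirchSwinnertonDyer.Theorems.DepletionAtTwo.ParamIntegral.stub_paramIntegralFormal W₁ m
  obtain ⟨hZ0, hZ1, A, hA⟩ := hZ W₁ f hW₁ L₁ hL₁ (m : ℚ) hc₁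
  set zq : PowerSeries ℤ := PowerSeries.mk k with hzq
  have hz0 : PowerSeries.constantCoeff zq = 0 := by
    have h := hk 0
    rw [PowerSeries.coeff_zero_eq_constantCoeff, hZ0] at h
    rw [hzq, ← PowerSeries.coeff_zero_eq_constantCoeff_apply, PowerSeries.coeff_mk]
    exact_mod_cast h.symm
  have hz1 : PowerSeries.coeff 1 zq ≠ 0 := by
    have h := hk 1
    rw [hZ1] at h
    rw [hzq, PowerSeries.coeff_mk]
    intro h0
    rw [h0, Int.cast_zero] at h
    exact hc₁ h
  have hzexp : ∃ A : ℝ, ∀ τ : UpperHalfPlane, A < τ.im →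
      HasSum (fun n : ℕ ↦ ((PowerSeries.coeff n zq : ℤ) : ℂ) *
          Complex.exp (2 * Real.pi * Complex.I * (τ : ℂ)) ^ n)
        (-(L₁.weierstrassP (((m : ℚ) : ℂ) * eichlerIntegral f τ) - ((W₁.b₂ : ℚ) : ℂ) / 12) /
          ((L₁.derivWeierstrassP (((m : ℚ) : ℂ) * eichlerIntegral f τ)
            - ((W₁.a₁ : ℚ) : ℂ) * (L₁.weierstrassP (((m : ℚ) : ℂ) * eichlerIntegral f τ) - ((W₁.b₂ : ℚ) : ℂ) / 12)
            - ((W₁.a₃ : ℚ) : ℂ)) / 2)) := by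
    refine ⟨A, fun τ hτ ↦ ?_⟩
    have hfun : (fun n : ℕ ↦ ((PowerSeries.coeff n zq : ℤ) : ℂ) * Complex.exp (2 * Real.pi * Complex.I * (τ : ℂ)) ^ n) =
        fun n : ℕ ↦ ((PowerSeries.coeff n (W₁.formalExp.subst
          (((m : ℤ) : ℚ) • (PowerSeries.mk fun j : ℕ ↦ ((W₁.LFunction j : ℤ) : ℚ) / j))) : ℚ) : ℂ) *
            Complex.exp (2 * Real.pi * Complex.I * (τ : ℂ)) ^ n := by
      funext n
      rw [hk n, hzq, PowerSeries.coeff_mk, Rat.cast_intCast]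
    rw [hfun]
    exact hA τ hτ
  -- S3 with S4 (closed, `N ≥ 5`)
  exact NsfDoor.sqrtCuspForm W₁ f hW₁ L₁ hL₁ (m : ℚ) hc₁ hin hout x₁ hx₁ lam hlam hlam2 hwp Γ' hΓ B hB0 hBsq hBhalf zq hz0 hz1
    hzexp (Summit.BirchSwinnertonDyer.BirchSwinnertonDyer.Theorems.DepletionAtTwo.Gamma1Bounded.stub_gamma1Bounded N (by omega))

/-- **«Stevens at 2» with an integer Manin constant, AT EVERY LEVEL, modulo UBD.**  A globally minimal elliptic `W₁/ℚ` with a newform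
`f ∈ S₂(Γ₀(N))` and Néron lattice `c₁Λ₁(f)`, `c₁ ∈ ℤ ∖ {0}` (the `X₁(N)`-optimal curve of its class carries such a datum: CES 2003 §6.1 /
Stevens 1989), has NO formal rational 2-torsion point: no rational 2-torsion abscissa `x₁` with `v₂(x₁) < 0`.  No parity, traceless-prime or
ordinarity hypothesis (cf. `NsfDoor.stevensAtTwoX1Int`, whose extra binders are idle).  Proof: half-period of the point
(`exists_half_period_of_hasRationalTwoTorsionX`), parity group (`…ParityGroup`), `parityCoverWt_allLevels`, and the congruence core
`…CongruenceCore.false_of_antiinvariant_integral_cuspForm_wt` (UBD + Wohlfahrt). CONDITIONAL on UBD.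
[cite: Stevens1989, §2] [cite: CalegariDimitrovTang2025, Thm. 1.0.1] -/
theorem stevensAtTwoX1Int_allLevels (hU : Literature.NumberTheory.Automorphic.CalegariDimitrovTang2025_unboundedDenominators) :
    ∀ (W₁ : WeierstrassCurve ℚ) [W₁.IsElliptic] [W₁.IsGloballyMinimal]
      ⦃N : ℕ⦄ [NeZero N] (f : CuspForm (CongruenceSubgroup.Gamma0 N) 2), IsNewformOf W₁ f →
      ∀ (L₁ : PeriodPair), IsNeronLatticeOf (W₁.baseChange ℂ) L₁ →
      ∀ (c₁ : ℚ), c₁ ≠ 0 → (∀ z ∈ periodLatticeGamma1 f, (c₁ : ℂ) * z ∈ L₁.lattice) →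
      (∀ z ∈ L₁.lattice, ∃ w ∈ periodLatticeGamma1 f, z = (c₁ : ℂ) * w) →
      (∃ m : ℤ, (m : ℚ) = c₁) →
      ∀ (x₁ : ℚ), HasRationalTwoTorsionX W₁ x₁ → ¬ TwoTorsionRamifiedAtTwo x₁ := by
  intro W₁ _ _ N _ f hW₁ L₁ hL₁ c₁ hc₁ hin hout hint x₁ hx₁ hram
  obtain ⟨lam, hlam, hlam2, hwp⟩ :=
    Literature.NumberTheory.EllipticCurves.exists_half_period_of_hasRationalTwoTorsionX W₁ L₁ hL₁ hx₁
  have hcover := parityCoverWt_allLevels W₁ f hW₁ L₁ hL₁ c₁ hc₁ hin hout hint x₁ hx₁ hram lam hlam hlam2 hwp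
  obtain ⟨Γ', hΓ⟩ :=
    Summit.BirchSwinnertonDyer.BirchSwinnertonDyer.Theorems.DepletionAtTwo.ParityGroup.exists_parityGroup f L₁ c₁ hin hlam hlam2
  obtain ⟨k, h, M, hh, hanti, hM, hint'⟩ := hcover Γ' hΓ
  haveI : Γ'.FiniteIndex :=
    Summit.BirchSwinnertonDyer.BirchSwinnertonDyer.Theorems.DepletionAtTwo.ParityGroup.finiteIndex_of_parity f L₁ c₁ hin hlam hlam2 hΓ
  have hpar : ∀ γ ∈ CongruenceSubgroup.Gamma1 N, (γ : Matrix (Fin 2) (Fin 2) ℤ).trace = 2 → γ ∈ Γ' :=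
    fun γ hγ htr ↦
      Summit.BirchSwinnertonDyer.BirchSwinnertonDyer.Theorems.DepletionAtTwo.ParityGroup.mem_of_trace_eq_two f L₁ c₁ lam hΓ hγ htr
  have hne : ∃ γ₀ ∈ CongruenceSubgroup.Gamma1 N, γ₀ ∉ Γ' :=
    Summit.BirchSwinnertonDyer.BirchSwinnertonDyer.Theorems.DepletionAtTwo.ParityGroup.exists_mem_gamma1_notMem f L₁ c₁ hin hlam
      hlam2 hΓ hout
  exact Summit.BirchSwinnertonDyer.BirchSwinnertonDyer.Theorems.DepletionAtTwo.CongruenceCore.false_of_antiinvariant_integral_cuspForm_wt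
    hU (NeZero.ne N) hpar hne h hh hanti hM hint'

end Summit.BirchSwinnertonDyer.BirchSwinnertonDyer.Theorems.DepletionAtTwo.StevensAllLevels

end
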